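/-
Copyright: harness cell b2b-lgcu-borel (gen 26).  Honest framing: the VALUE here is a THEOREM
(a decidable NEGATIVE verdict on an infinite slice of the crux: all subgroup triples of
`GL_3(𝔽_p)`, `p ∈ {41, 43, 47, 53}`, below an explicit `ε`) — NOT summit progress; the crux item
`SubgroupIdentityDesigns` (stmt-MatrixMultiplication-14079) stays open and untouched.
-/
import Mathlib
import Literature.Barriers.RiemannHypothesis.EpsteinZetaRealZerosIntegralWitness
import Summits.MatrixMultiplication.MatrixMultiplication.Theorems.SubgroupIdentityDesigns.Negative.LevelOneEpsilonFloor

/-!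
# The `ε`-window of the level-one cells `(m, p) = (3, 41), (3, 43), (3, 47), (3, 53)`

Route `LevelGradedCohnUmans`, crux `SubgroupIdentityDesigns`, negative side; level `k = 1`.
Third file of the series `LevelOneEpsilonCells` (`p = 11, 13, 17, 19`), `LevelOneEpsilonCellsTwo`
(`p = 23, 29, 31, 37`); same mechanism: the general-exponent floor
`LevelOneEpsilonFloor.floor_exp` against the volume law of `WitnessNeumannCounts.crux_volume_law`.

* `cert_fortyone`, …, `cert_fiftythree` : pure arithmetic certificates by `norm_num` (generated and
  checked exactly by `code/g26/lean/gen_cells3.py`);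
* `no_levelOne_witness_three_fortyone` : **at `(m, p) = (3, 41)` NO subgroup-TPP triple with a
  level-one identity design satisfies the crux inequality for ANY `−2 < ε ≤ 2/5`** (`t = 12/5`,
  margin 3.3 %);
* `no_levelOne_witness_three_fortythree` / `_fortyseven` / `_fiftythree` : `(3, 43)`, `(3, 47)`,
  `(3, 53)` for `−2 < ε ≤ 1/3` (`t = 7/3`; margins 16.6 %, 14.4 %, 11.4 %);
* `no_crux_instance_three_fortyone`, `no_crux_instance_three_fortythree_fortyseven_fiftythree` :
  the crux clause verbatim at `m = 3`.

So these cells are open only in the windows `ε ∈ (2/5, 1]` (`p = 41`) and `(1/3, 1]`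
(`p = 43, 47, 53`); the method's reach `ε*(p) ≈ 0.85 / log p` passes below `1/3` near `p ≈ 70`.
Sorry-free; standard axioms; no new definitions.  Report:
`run/shared/lean/b2b/levelgraded-cu/ORACLE-g26.md` §G26-2.
-/

set_option linter.dupNamespace false

noncomputable section

open scoped BigOperators Classical Matrix
open Module (finrank)

namespace Summit.MatrixMultiplication.MatrixMultiplication.Theorems.SubgroupIdentityDesigns.Negative
namespace LevelOneEpsilonCellsThree

open Literature.Barriers.MatrixMultiplication (SubgroupTPP)
open Summit.MatrixMultiplication.MatrixMultiplication.Theorems.LieRankDesigns.Negative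
  (GLm Mat budget)
open Summit.MatrixMultiplication.MatrixMultiplication.Theorems.LevelOneGL2Designs.Negative
  (levelSubmodule)
open LevelOneFloorAll (finrank_le_formula_nat)
open WitnessNeumannCounts (crux_volume_law)
open LevelOneEpsilonFloor (floor_exp volume_cap quad_trichotomy volume_real cell_absurd)
-- root comparisons `c^n ≤ x^k ⇒ c ≤ x^{k/n}` (generic real-analysis helpers already in the tree)
open Literature.Barriers.RiemannHypothesis (le_rpow_of_pow_le rpow_le_of_pow_le)

variable {p : ℕ} [hp : Fact p.Prime]

/-! ## The cell `(3, 41)`: no witness unless `ε > 2/5` -/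

/-- Arithmetic certificate of the cell `(3, 41)`: `D ≤ 118745716`, volume cap `V ≤ 498091985248`
(`u = 6292`), floor exponent `t = 12/5`: `58408970 ≤ 1722^t`, `58490410 ≤ 1723^t`,
`498091985248^(t/3) ≤ 2339534961`. -/
theorem cert_fortyone {u D V : ℕ} (hu1 : 1 ≤ u) (hvol : V + u * u * (u - 1) ≤ u * D)
    (hD : D + 2 * 1723 ≤ (41 - 1) * 1723 ^ 2 + 2)
    (hfl : 1 + (((1723 : ℕ) : ℝ) - 1) ^ ((12 : ℝ) / 5) +
      (((41 : ℕ) : ℝ) - 2) * ((1723 : ℕ) : ℝ) ^ ((12 : ℝ) / 5) <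
      ((V : ℕ) : ℝ) ^ ((12 : ℝ) / 5 / 3)) : False := by
  have hDm : D ≤ 118745716 := by norm_num at hD; omega
  obtain ⟨w, hw⟩ := volume_real hu1 hvol hDm
  have hw0 : (0 : ℝ) ≤ w := Nat.cast_nonneg _
  have hq := quad_trichotomy (w := w) (w₀ := 6291) (D := ((118745716 : ℕ) : ℝ)) (by norm_num)
    (by norm_num)
  have hcap := volume_cap (w₀ := ((6291 : ℕ) : ℝ)) hw0 hw le_rfl hq
  have hVM : ((V : ℕ) : ℝ) ≤ 498091985248 := by norm_num at hcap; exact_mod_cast hcap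
  have e1 : (((1723 : ℕ) : ℝ) - 1) = 1722 := by norm_num
  have e2 : (((41 : ℕ) : ℝ) - 2) = 39 := by norm_num
  have e3 : (((1723 : ℕ) : ℝ)) = 1723 := by norm_num
  have e4 : ((12 : ℝ) / 5 / 3) = (12 : ℝ) / 15 := by norm_num
  rw [e1, e2, e3, e4] at hfl
  have h2 : (58408970 : ℝ) ≤ (1722 : ℝ) ^ ((12 : ℝ) / 5) :=
    le_rpow_of_pow_le (k := 12) (n := 5) (by norm_num) (by norm_num) (by norm_num)
      (by norm_num) (by norm_num)
  have h1 : (58490410 : ℝ) ≤ (1723 : ℝ) ^ ((12 : ℝ) / 5) :=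
    le_rpow_of_pow_le (k := 12) (n := 5) (by norm_num) (by norm_num) (by norm_num)
      (by norm_num) (by norm_num)
  have hM : (498091985248 : ℝ) ^ ((12 : ℝ) / 15) ≤ 1 + 58408970 + 39 * 58490410 :=
    rpow_le_of_pow_le (k := 12) (n := 15) (by norm_num) (by norm_num) (by norm_num)
      (by norm_num) (by norm_num)
  exact cell_absurd (Nat.cast_nonneg V) hVM (by norm_num) (by norm_num) hfl h2 h1 hM

/-- **NO LEVEL-ONE WITNESS AT `(m, p) = (3, 41)` FOR `−2 < ε ≤ 2/5`** (all subgroup triples; TPP and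
a level-one identity design only feed the volume law). -/
theorem no_levelOne_witness_three_fortyone (hp' : p = 41) {ε : ℝ} (hε : -2 < ε) (hε1 : ε ≤ 2 / 5)
    {H₁ H₂ H₃ : Subgroup (GLm p (1 + 2))} (htpp : SubgroupTPP H₁ H₂ H₃)
    (hdes : ∃ c : Mat p (1 + 2) → ℂ, (∀ M, 1 < M.rank → c M = 0) ∧
      (∑ M, c M * ZMod.stdAddChar (Matrix.trace (M * ((1 : GLm p (1 + 2)) : Mat p (1 + 2))))) = 1 ∧
      ∀ a ∈ H₁, ∀ b ∈ H₂, ∀ g ∈ H₃, a * b * g ≠ 1 →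
        (∑ M, c M * ZMod.stdAddChar
          (Matrix.trace (M * ((a * b * g : GLm p (1 + 2)) : Mat p (1 + 2))))) = 0) :
    ¬ budget p (1 + 2) 1 (2 + ε) <
      ((Nat.card H₁ * Nat.card H₂ * Nat.card H₃ : ℕ) : ℝ) ^ ((2 + ε) / 3) := by
  intro hlt
  subst hp'
  obtain ⟨u, hu1, -, -, -, -, hvol⟩ := crux_volume_law (k := 1) htpp hdes
  have hfl := floor_exp (p := 41) (l := 2) (t := (12 : ℝ) / 5) (by omega) hε (by linarith) hlt
  have hD := finrank_le_formula_nat (p := 41) (l := 2)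
  have hb : (41 ^ (1 + 2) - 1) / (41 - 1) = 1723 := by norm_num
  rw [hb] at hfl hD
  generalize finrank ℂ (levelSubmodule 41 (1 + 2) 1) = D at hD hvol
  generalize Nat.card H₁ * Nat.card H₂ * Nat.card H₃ = V at hfl hvol
  exact cert_fortyone hu1 hvol hD hfl

/-! ## The cells `(3, 43)`, `(3, 47)`, `(3, 53)`: no witness unless `ε > 1/3` -/

/-- Arithmetic certificate of the cell `(3, 43)`: `D ≤ 150501074`, volume cap `V ≤ 710703035244`
(`u = 7083`), floor exponent `t = 7/3`: `44274055 ≤ 1892^t`, `44328676 ≤ 1893^t`,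
`710703035244^(t/3) ≤ 1861749772`. -/
theorem cert_fortythree {u D V : ℕ} (hu1 : 1 ≤ u) (hvol : V + u * u * (u - 1) ≤ u * D)
    (hD : D + 2 * 1893 ≤ (43 - 1) * 1893 ^ 2 + 2)
    (hfl : 1 + (((1893 : ℕ) : ℝ) - 1) ^ ((7 : ℝ) / 3) +
      (((43 : ℕ) : ℝ) - 2) * ((1893 : ℕ) : ℝ) ^ ((7 : ℝ) / 3) <
      ((V : ℕ) : ℝ) ^ ((7 : ℝ) / 3 / 3)) : False := by
  have hDm : D ≤ 150501074 := by norm_num at hD; omega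
  obtain ⟨w, hw⟩ := volume_real hu1 hvol hDm
  have hw0 : (0 : ℝ) ≤ w := Nat.cast_nonneg _
  have hq := quad_trichotomy (w := w) (w₀ := 7082) (D := ((150501074 : ℕ) : ℝ)) (by norm_num)
    (by norm_num)
  have hcap := volume_cap (w₀ := ((7082 : ℕ) : ℝ)) hw0 hw le_rfl hq
  have hVM : ((V : ℕ) : ℝ) ≤ 710703035244 := by norm_num at hcap; exact_mod_cast hcap
  have e1 : (((1893 : ℕ) : ℝ) - 1) = 1892 := by norm_num
  have e2 : (((43 : ℕ) : ℝ) - 2) = 41 := by norm_num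
  have e3 : (((1893 : ℕ) : ℝ)) = 1893 := by norm_num
  have e4 : ((7 : ℝ) / 3 / 3) = (7 : ℝ) / 9 := by norm_num
  rw [e1, e2, e3, e4] at hfl
  have h2 : (44274055 : ℝ) ≤ (1892 : ℝ) ^ ((7 : ℝ) / 3) :=
    le_rpow_of_pow_le (k := 7) (n := 3) (by norm_num) (by norm_num) (by norm_num)
      (by norm_num) (by norm_num)
  have h1 : (44328676 : ℝ) ≤ (1893 : ℝ) ^ ((7 : ℝ) / 3) :=
    le_rpow_of_pow_le (k := 7) (n := 3) (by norm_num) (by norm_num) (by norm_num)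
      (by norm_num) (by norm_num)
  have hM : (710703035244 : ℝ) ^ ((7 : ℝ) / 9) ≤ 1 + 44274055 + 41 * 44328676 :=
    rpow_le_of_pow_le (k := 7) (n := 9) (by norm_num) (by norm_num) (by norm_num)
      (by norm_num) (by norm_num)
  exact cell_absurd (Nat.cast_nonneg V) hVM (by norm_num) (by norm_num) hfl h2 h1 hM

/-- **NO LEVEL-ONE WITNESS AT `(m, p) = (3, 43)` FOR `−2 < ε ≤ 1/3`** (all subgroup triples; TPP and
a level-one identity design only feed the volume law). -/
theorem no_levelOne_witness_three_fortythree (hp' : p = 43) {ε : ℝ} (hε : -2 < ε) (hε1 : ε ≤ 1 / 3)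
    {H₁ H₂ H₃ : Subgroup (GLm p (1 + 2))} (htpp : SubgroupTPP H₁ H₂ H₃)
    (hdes : ∃ c : Mat p (1 + 2) → ℂ, (∀ M, 1 < M.rank → c M = 0) ∧
      (∑ M, c M * ZMod.stdAddChar (Matrix.trace (M * ((1 : GLm p (1 + 2)) : Mat p (1 + 2))))) = 1 ∧
      ∀ a ∈ H₁, ∀ b ∈ H₂, ∀ g ∈ H₃, a * b * g ≠ 1 →
        (∑ M, c M * ZMod.stdAddChar
          (Matrix.trace (M * ((a * b * g : GLm p (1 + 2)) : Mat p (1 + 2))))) = 0) :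
    ¬ budget p (1 + 2) 1 (2 + ε) <
      ((Nat.card H₁ * Nat.card H₂ * Nat.card H₃ : ℕ) : ℝ) ^ ((2 + ε) / 3) := by
  intro hlt
  subst hp'
  obtain ⟨u, hu1, -, -, -, -, hvol⟩ := crux_volume_law (k := 1) htpp hdes
  have hfl := floor_exp (p := 43) (l := 2) (t := (7 : ℝ) / 3) (by omega) hε (by linarith) hlt
  have hD := finrank_le_formula_nat (p := 43) (l := 2)
  have hb : (43 ^ (1 + 2) - 1) / (43 - 1) = 1893 := by norm_num
  rw [hb] at hfl hD
  generalize finrank ℂ (levelSubmodule 43 (1 + 2) 1) = D at hD hvol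
  generalize Nat.card H₁ * Nat.card H₂ * Nat.card H₃ = V at hfl hvol
  exact cert_fortythree hu1 hvol hD hfl

/-- Arithmetic certificate of the cell `(3, 47)`: `D ≤ 234321742`, volume cap `V ≤ 1380675329568`
(`u = 8838`), floor exponent `t = 7/3`: `66751017 ≤ 2256^t`, `66820076 ≤ 2257^t`,
`1380675329568^(t/3) ≤ 3073654438`. -/
theorem cert_fortyseven {u D V : ℕ} (hu1 : 1 ≤ u) (hvol : V + u * u * (u - 1) ≤ u * D)
    (hD : D + 2 * 2257 ≤ (47 - 1) * 2257 ^ 2 + 2)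
    (hfl : 1 + (((2257 : ℕ) : ℝ) - 1) ^ ((7 : ℝ) / 3) +
      (((47 : ℕ) : ℝ) - 2) * ((2257 : ℕ) : ℝ) ^ ((7 : ℝ) / 3) <
      ((V : ℕ) : ℝ) ^ ((7 : ℝ) / 3 / 3)) : False := by
  have hDm : D ≤ 234321742 := by norm_num at hD; omega
  obtain ⟨w, hw⟩ := volume_real hu1 hvol hDm
  have hw0 : (0 : ℝ) ≤ w := Nat.cast_nonneg _
  have hq := quad_trichotomy (w := w) (w₀ := 8837) (D := ((234321742 : ℕ) : ℝ)) (by norm_num)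
    (by norm_num)
  have hcap := volume_cap (w₀ := ((8837 : ℕ) : ℝ)) hw0 hw le_rfl hq
  have hVM : ((V : ℕ) : ℝ) ≤ 1380675329568 := by norm_num at hcap; exact_mod_cast hcap
  have e1 : (((2257 : ℕ) : ℝ) - 1) = 2256 := by norm_num
  have e2 : (((47 : ℕ) : ℝ) - 2) = 45 := by norm_num
  have e3 : (((2257 : ℕ) : ℝ)) = 2257 := by norm_num
  have e4 : ((7 : ℝ) / 3 / 3) = (7 : ℝ) / 9 := by norm_num
  rw [e1, e2, e3, e4] at hfl
  have h2 : (66751017 : ℝ) ≤ (2256 : ℝ) ^ ((7 : ℝ) / 3) :=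
    le_rpow_of_pow_le (k := 7) (n := 3) (by norm_num) (by norm_num) (by norm_num)
      (by norm_num) (by norm_num)
  have h1 : (66820076 : ℝ) ≤ (2257 : ℝ) ^ ((7 : ℝ) / 3) :=
    le_rpow_of_pow_le (k := 7) (n := 3) (by norm_num) (by norm_num) (by norm_num)
      (by norm_num) (by norm_num)
  have hM : (1380675329568 : ℝ) ^ ((7 : ℝ) / 9) ≤ 1 + 66751017 + 45 * 66820076 :=
    rpow_le_of_pow_le (k := 7) (n := 9) (by norm_num) (by norm_num) (by norm_num)
      (by norm_num) (by norm_num)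
  exact cell_absurd (Nat.cast_nonneg V) hVM (by norm_num) (by norm_num) hfl h2 h1 hM

/-- **NO LEVEL-ONE WITNESS AT `(m, p) = (3, 47)` FOR `−2 < ε ≤ 1/3`** (all subgroup triples; TPP and
a level-one identity design only feed the volume law). -/
theorem no_levelOne_witness_three_fortyseven (hp' : p = 47) {ε : ℝ} (hε : -2 < ε) (hε1 : ε ≤ 1 / 3)
    {H₁ H₂ H₃ : Subgroup (GLm p (1 + 2))} (htpp : SubgroupTPP H₁ H₂ H₃)
    (hdes : ∃ c : Mat p (1 + 2) → ℂ, (∀ M, 1 < M.rank → c M = 0) ∧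
      (∑ M, c M * ZMod.stdAddChar (Matrix.trace (M * ((1 : GLm p (1 + 2)) : Mat p (1 + 2))))) = 1 ∧
      ∀ a ∈ H₁, ∀ b ∈ H₂, ∀ g ∈ H₃, a * b * g ≠ 1 →
        (∑ M, c M * ZMod.stdAddChar
          (Matrix.trace (M * ((a * b * g : GLm p (1 + 2)) : Mat p (1 + 2))))) = 0) :
    ¬ budget p (1 + 2) 1 (2 + ε) <
      ((Nat.card H₁ * Nat.card H₂ * Nat.card H₃ : ℕ) : ℝ) ^ ((2 + ε) / 3) := by
  intro hlt
  subst hp'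
  obtain ⟨u, hu1, -, -, -, -, hvol⟩ := crux_volume_law (k := 1) htpp hdes
  have hfl := floor_exp (p := 47) (l := 2) (t := (7 : ℝ) / 3) (by omega) hε (by linarith) hlt
  have hD := finrank_le_formula_nat (p := 47) (l := 2)
  have hb : (47 ^ (1 + 2) - 1) / (47 - 1) = 2257 := by norm_num
  rw [hb] at hfl hD
  generalize finrank ℂ (levelSubmodule 47 (1 + 2) 1) = D at hD hvol
  generalize Nat.card H₁ * Nat.card H₂ * Nat.card H₃ = V at hfl hvol
  exact cert_fortyseven hu1 hvol hD hfl

/-- Arithmetic certificate of the cell `(3, 53)`: `D ≤ 426226264`, volume cap `V ≤ 3387089265280`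
(`u = 11920`), floor exponent `t = 7/3`: `116295381 ≤ 2862^t`, `116390217 ≤ 2863^t`,
`3387089265280^(t/3) ≤ 6052196449`. -/
theorem cert_fiftythree {u D V : ℕ} (hu1 : 1 ≤ u) (hvol : V + u * u * (u - 1) ≤ u * D)
    (hD : D + 2 * 2863 ≤ (53 - 1) * 2863 ^ 2 + 2)
    (hfl : 1 + (((2863 : ℕ) : ℝ) - 1) ^ ((7 : ℝ) / 3) +
      (((53 : ℕ) : ℝ) - 2) * ((2863 : ℕ) : ℝ) ^ ((7 : ℝ) / 3) <
      ((V : ℕ) : ℝ) ^ ((7 : ℝ) / 3 / 3)) : False := by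
  have hDm : D ≤ 426226264 := by norm_num at hD; omega
  obtain ⟨w, hw⟩ := volume_real hu1 hvol hDm
  have hw0 : (0 : ℝ) ≤ w := Nat.cast_nonneg _
  have hq := quad_trichotomy (w := w) (w₀ := 11919) (D := ((426226264 : ℕ) : ℝ)) (by norm_num)
    (by norm_num)
  have hcap := volume_cap (w₀ := ((11919 : ℕ) : ℝ)) hw0 hw le_rfl hq
  have hVM : ((V : ℕ) : ℝ) ≤ 3387089265280 := by norm_num at hcap; exact_mod_cast hcap
  have e1 : (((2863 : ℕ) : ℝ) - 1) = 2862 := by norm_num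
  have e2 : (((53 : ℕ) : ℝ) - 2) = 51 := by norm_num
  have e3 : (((2863 : ℕ) : ℝ)) = 2863 := by norm_num
  have e4 : ((7 : ℝ) / 3 / 3) = (7 : ℝ) / 9 := by norm_num
  rw [e1, e2, e3, e4] at hfl
  have h2 : (116295381 : ℝ) ≤ (2862 : ℝ) ^ ((7 : ℝ) / 3) :=
    le_rpow_of_pow_le (k := 7) (n := 3) (by norm_num) (by norm_num) (by norm_num)
      (by norm_num) (by norm_num)
  have h1 : (116390217 : ℝ) ≤ (2863 : ℝ) ^ ((7 : ℝ) / 3) :=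
    le_rpow_of_pow_le (k := 7) (n := 3) (by norm_num) (by norm_num) (by norm_num)
      (by norm_num) (by norm_num)
  have hM : (3387089265280 : ℝ) ^ ((7 : ℝ) / 9) ≤ 1 + 116295381 + 51 * 116390217 :=
    rpow_le_of_pow_le (k := 7) (n := 9) (by norm_num) (by norm_num) (by norm_num)
      (by norm_num) (by norm_num)
  exact cell_absurd (Nat.cast_nonneg V) hVM (by norm_num) (by norm_num) hfl h2 h1 hM

/-- **NO LEVEL-ONE WITNESS AT `(m, p) = (3, 53)` FOR `−2 < ε ≤ 1/3`** (all subgroup triples; TPP and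
a level-one identity design only feed the volume law). -/
theorem no_levelOne_witness_three_fiftythree (hp' : p = 53) {ε : ℝ} (hε : -2 < ε) (hε1 : ε ≤ 1 / 3)
    {H₁ H₂ H₃ : Subgroup (GLm p (1 + 2))} (htpp : SubgroupTPP H₁ H₂ H₃)
    (hdes : ∃ c : Mat p (1 + 2) → ℂ, (∀ M, 1 < M.rank → c M = 0) ∧
      (∑ M, c M * ZMod.stdAddChar (Matrix.trace (M * ((1 : GLm p (1 + 2)) : Mat p (1 + 2))))) = 1 ∧
      ∀ a ∈ H₁, ∀ b ∈ H₂, ∀ g ∈ H₃, a * b * g ≠ 1 →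
        (∑ M, c M * ZMod.stdAddChar
          (Matrix.trace (M * ((a * b * g : GLm p (1 + 2)) : Mat p (1 + 2))))) = 0) :
    ¬ budget p (1 + 2) 1 (2 + ε) <
      ((Nat.card H₁ * Nat.card H₂ * Nat.card H₃ : ℕ) : ℝ) ^ ((2 + ε) / 3) := by
  intro hlt
  subst hp'
  obtain ⟨u, hu1, -, -, -, -, hvol⟩ := crux_volume_law (k := 1) htpp hdes
  have hfl := floor_exp (p := 53) (l := 2) (t := (7 : ℝ) / 3) (by omega) hε (by linarith) hlt
  have hD := finrank_le_formula_nat (p := 53) (l := 2)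
  have hb : (53 ^ (1 + 2) - 1) / (53 - 1) = 2863 := by norm_num
  rw [hb] at hfl hD
  generalize finrank ℂ (levelSubmodule 53 (1 + 2) 1) = D at hD hvol
  generalize Nat.card H₁ * Nat.card H₂ * Nat.card H₃ = V at hfl hvol
  exact cert_fiftythree hu1 hvol hD hfl

/-! ## The crux clause verbatim at `m = 3` -/

/-- **The crux clause verbatim has no level-one instance at `(m, p) = (3, 41)` for any
`−2 < ε ≤ 2/5`** — the cell is open only in the window `ε ∈ (2/5, 1]`. -/
theorem no_crux_instance_three_fortyone (hp' : p = 41) {ε : ℝ} (hε : -2 < ε)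
    (hε1 : ε ≤ 2 / 5) :
    ¬ ∃ (H₁ H₂ H₃ : Subgroup (Matrix.GeneralLinearGroup (Fin 3) (ZMod p))),
      Literature.Barriers.MatrixMultiplication.SubgroupTPP H₁ H₂ H₃ ∧
      (∃ c : Matrix (Fin 3) (Fin 3) (ZMod p) → ℂ, (∀ M, 1 < M.rank → c M = 0) ∧
        (∑ M : Matrix (Fin 3) (Fin 3) (ZMod p), c M * ZMod.stdAddChar
          (Matrix.trace (M * ((1 : Matrix.GeneralLinearGroup (Fin 3) (ZMod p)) :
            Matrix (Fin 3) (Fin 3) (ZMod p))))) = 1 ∧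
        ∀ a ∈ H₁, ∀ b ∈ H₂, ∀ g ∈ H₃, a * b * g ≠ 1 →
          (∑ M : Matrix (Fin 3) (Fin 3) (ZMod p), c M * ZMod.stdAddChar
            (Matrix.trace (M * ((a * b * g : Matrix.GeneralLinearGroup (Fin 3) (ZMod p)) :
              Matrix (Fin 3) (Fin 3) (ZMod p))))) = 0) ∧
      (∑ᶠ χ ∈ Literature.RepresentationTheory.FiniteGroups.irrChars
          (Matrix.GeneralLinearGroup (Fin 3) (ZMod p)) ∩
          {f | ∃ c : Matrix (Fin 3) (Fin 3) (ZMod p) → ℂ, (∀ M, 1 < M.rank → c M = 0) ∧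
            ∀ g : Matrix.GeneralLinearGroup (Fin 3) (ZMod p), f g =
              ∑ M : Matrix (Fin 3) (Fin 3) (ZMod p), c M * ZMod.stdAddChar
                (Matrix.trace (M * (g : Matrix (Fin 3) (Fin 3) (ZMod p))))},
        (χ 1).re ^ (2 + ε)) <
        ((Nat.card H₁ * Nat.card H₂ * Nat.card H₃ : ℕ) : ℝ) ^ ((2 + ε) / 3) := by
  rintro ⟨H₁, H₂, H₃, htpp, hdesign, hlt⟩
  exact no_levelOne_witness_three_fortyone hp' hε hε1 htpp hdesign hlt

/-- **The crux clause verbatim has no level-one instance at `(m, p) = (3, 43)`, `(3, 47)` or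
`(3, 53)` for any `−2 < ε ≤ 1/3`.** -/
theorem no_crux_instance_three_fortythree_fortyseven_fiftythree
    (hp' : p = 43 ∨ p = 47 ∨ p = 53) {ε : ℝ} (hε : -2 < ε) (hε1 : ε ≤ 1 / 3) :
    ¬ ∃ (H₁ H₂ H₃ : Subgroup (Matrix.GeneralLinearGroup (Fin 3) (ZMod p))),
      Literature.Barriers.MatrixMultiplication.SubgroupTPP H₁ H₂ H₃ ∧
      (∃ c : Matrix (Fin 3) (Fin 3) (ZMod p) → ℂ, (∀ M, 1 < M.rank → c M = 0) ∧
        (∑ M : Matrix (Fin 3) (Fin 3) (ZMod p), c M * ZMod.stdAddChar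
          (Matrix.trace (M * ((1 : Matrix.GeneralLinearGroup (Fin 3) (ZMod p)) :
            Matrix (Fin 3) (Fin 3) (ZMod p))))) = 1 ∧
        ∀ a ∈ H₁, ∀ b ∈ H₂, ∀ g ∈ H₃, a * b * g ≠ 1 →
          (∑ M : Matrix (Fin 3) (Fin 3) (ZMod p), c M * ZMod.stdAddChar
            (Matrix.trace (M * ((a * b * g : Matrix.GeneralLinearGroup (Fin 3) (ZMod p)) :
              Matrix (Fin 3) (Fin 3) (ZMod p))))) = 0) ∧
      (∑ᶠ χ ∈ Literature.RepresentationTheory.FiniteGroups.irrChars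
          (Matrix.GeneralLinearGroup (Fin 3) (ZMod p)) ∩
          {f | ∃ c : Matrix (Fin 3) (Fin 3) (ZMod p) → ℂ, (∀ M, 1 < M.rank → c M = 0) ∧
            ∀ g : Matrix.GeneralLinearGroup (Fin 3) (ZMod p), f g =
              ∑ M : Matrix (Fin 3) (Fin 3) (ZMod p), c M * ZMod.stdAddChar
                (Matrix.trace (M * (g : Matrix (Fin 3) (Fin 3) (ZMod p))))},
        (χ 1).re ^ (2 + ε)) <
        ((Nat.card H₁ * Nat.card H₂ * Nat.card H₃ : ℕ) : ℝ) ^ ((2 + ε) / 3) := by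
  rintro ⟨H₁, H₂, H₃, htpp, hdesign, hlt⟩
  rcases hp' with h | h | h
  · exact no_levelOne_witness_three_fortythree h hε hε1 htpp hdesign hlt
  · exact no_levelOne_witness_three_fortyseven h hε hε1 htpp hdesign hlt
  · exact no_levelOne_witness_three_fiftythree h hε hε1 htpp hdesign hlt

end LevelOneEpsilonCellsThree

end Summit.MatrixMultiplication.MatrixMultiplication.Theorems.SubgroupIdentityDesigns.Negative
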